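import Literature.MathematicalPhysics.QuantumLattice.HubbardModel
import Literature.MathematicalPhysics.QuantumLattice.FreeFermionSpinTwistedTraceFormula
import Literature.Probability.LatticeModels.TorusFourierProofs
import HarnessLib

/-!
# Plane-wave inversion of translation-invariant two-orbital matrices on the fermionic torus

Topic `Literature/MathematicalPhysics/QuantumLattice` (family `hubbard`), in the story of
`HubbardModel.lean` (the fermionic torus `FermionTorus d L`, orbitals `Orb Λ = Λ ×ₗ Fin 2`) and
`Literature/Probability/LatticeModels/TorusFourierProofs.lean` (the characters `torusChar k x` of
`(ℤ/Lℤ)^d` and their orthogonality).  The Bloch–Fourier diagonalisation of a translation-invariant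
one-body (Nambu / two-orbital) matrix, in the form needed to write a free lattice RESOLVENT as a
momentum sum of its `2 × 2` symbol.  Fully proved, no definition is introduced:

* `torusChar_single_eq_exp`, `torusChar_stencil` — `χ_k(eᵢ) = e^{2πi kᵢ/L}` and the
  nearest-neighbour stencil on plane waves,
  `χ_k(v + eᵢ − w) + χ_k(v − eᵢ − w) = 2cos(2πkᵢ/L) χ_k(v − w)`;
* `sum_ite_shift_mul`, `sum_ite_unshift_mul` — collapsing the shift indicators `[y = x ± e]` of
  bond data spread on ordered site pairs of the fermionic torus;
* `inv_apply_eq_sum_torusChar` — **plane-wave inversion**: if `Σ_y M((x,σ),(y,σ')) χ_k(y − w) =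
  χ_k(x − w) N̂(k)_{σσ'}` for all plane waves and `N̂(k) Ŝ(k) = 1₂` for all momenta, then
  `M⁻¹((x,σ),(y,σ')) = L^{-d} Σ_k χ_k(x − y) Ŝ(k)_{σσ'}` (`M * G = 1` by orthogonality of characters,
  then `Matrix.inv_eq_right_inv`);
* `stdAddChar_natCast_mul`, `sum_torusChar_mul_eq_sum_fin_fin` — in `d = 2`, momentum sums as
  explicit double grid sums `Σ_{j₁ j₂ < L} e^{2πi v₀j₁/L} e^{2πi v₁j₂/L} Φ(2πj₁/L, 2πj₂/L)` (the
  form consumed by one-dimensional summation by parts, `TorusResolventSummationByParts.lean`).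

## Mathlib / tree search

REUSED (tree): `torusChar`, `torusChar_add_right`, `torusChar_sub_right`, `sum_torusChar_left`,
`natCast_pow_ne_zero` (`TorusFourierProofs`); `FermionTorus.equivTorusSite`,
`FermionTorus.toTorusSite_ofTorusSite` (`HubbardModel`); `sum_orb_eq_sum_sum`
(`FreeFermionSpinTwistedTraceFormula`).  REUSED (Mathlib): `ZMod.stdAddChar_apply`,
`ZMod.toCircle_apply`, `ZMod.toCircle_natCast`, `Complex.exp_nat_mul_two_pi_mul_I`,
`Matrix.inv_eq_right_inv`, `Fintype.sum_bijective`.  Related tree results NOT reused: the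
plane-wave CONJUGATION lemmas `hat_circulant`, `hat_diagonal_apply` of
`Summits/…/Theorems/BalabanIRBirBdGPhaseCoercivityFourier.lean` (scalar circulants indexed by
`TorusSite`, not two-orbital matrices indexed by `Orb (FermionTorus d L)`), and
`Literature/Probability/LatticeModels/GaussianDomination.lean:torusChar_single` (assumes `L ≥ 2`,
phrased with `latticeMomentum`).

## References

S. Friedli, Y. Velenik, *Statistical Mechanics of Lattice Systems* (CUP 2017), §10.4 (Fourier
analysis on the discrete torus); P. G. de Gennes, *Superconductivity of Metals and Alloys* (1966),
Ch. 5 (momentum-space BdG / Nambu matrices of translation-invariant superconductors).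
-/

noncomputable section

namespace Literature.MathematicalPhysics.QuantumLattice

open Finset Literature.Probability.LatticeModels
open scoped ComplexConjugate Real

section PlaneWave

variable {d L : ℕ} [NeZero L]

/-- The character at a unit vector: `χ_k(eᵢ) = e^{2πi kᵢ/L}`. [folklore] -/
theorem torusChar_single_eq_exp (k : TorusSite d L) (i : Fin d) :
    torusChar k (Pi.single i 1) = Complex.exp (2 * π * Complex.I * ((k i).val : ℕ) / L) := by
  classical
  unfold torusChar
  have h : ∀ i' : Fin d,
      (ZMod.stdAddChar (k i' * (Pi.single i (1 : ZMod L) : TorusSite d L) i') : ℂ) =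
        if i' = i then (ZMod.stdAddChar (k i) : ℂ) else 1 := fun i' => by
    by_cases hi : i' = i
    · subst hi; simp
    · simp [hi]
  rw [Finset.prod_congr rfl fun i' _ => h i', Finset.prod_ite_eq']
  simp only [Finset.mem_univ, if_true]
  rw [ZMod.stdAddChar_apply, ZMod.toCircle_apply]

/-- **Plane waves are eigenvectors of the nearest-neighbour stencil**:
`χ_k(v + eᵢ − w) + χ_k(v − eᵢ − w) = 2cos(2π kᵢ/L) χ_k(v − w)`. [folklore] -/
theorem torusChar_stencil (k v w : TorusSite d L) (i : Fin d) :
    torusChar k (v + Pi.single i 1 - w) + torusChar k (v - Pi.single i 1 - w) =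
      2 * Real.cos (2 * π * ((k i).val : ℕ) / L) * torusChar k (v - w) := by
  have e1 : v + Pi.single i 1 - w = (v - w) + Pi.single i 1 := by abel
  have e2 : v - Pi.single i 1 - w = (v - w) - Pi.single i 1 := by abel
  rw [e1, e2, torusChar_add_right, torusChar_sub_right k (v - w) (Pi.single i 1),
    torusChar_single_eq_exp]
  have h : Complex.exp (2 * π * Complex.I * ((k i).val : ℕ) / L) =
      Complex.exp ((2 * π * ((k i).val : ℕ) / L : ℝ) * Complex.I) := by
    congr 1; push_cast; ring
  rw [h, ← mul_add, Complex.add_conj, Complex.exp_ofReal_mul_I_re]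
  push_cast
  ring

/-- Summing a forward-shift indicator over the fermionic torus:
`Σ_y [y = x + e] c Φ(y) = c Φ(x + e)`. [folklore] -/
theorem sum_ite_shift_mul (x : FermionTorus d L) (e : TorusSite d L) (c : ℂ)
    (Φ : TorusSite d L → ℂ) :
    ∑ y : FermionTorus d L,
        (if y.toTorusSite = x.toTorusSite + e then c else 0) * Φ y.toTorusSite =
      c * Φ (x.toTorusSite + e) := by
  rw [← Equiv.sum_comp FermionTorus.equivTorusSite.symm]
  simp only [FermionTorus.equivTorusSite, Equiv.coe_fn_symm_mk,
    FermionTorus.toTorusSite_ofTorusSite, ite_mul, zero_mul, Finset.sum_ite_eq', Finset.mem_univ,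
    if_true]

/-- Summing a backward-shift indicator over the fermionic torus:
`Σ_y [x = y + e] c Φ(y) = c Φ(x − e)`. [folklore] -/
theorem sum_ite_unshift_mul (x : FermionTorus d L) (e : TorusSite d L) (c : ℂ)
    (Φ : TorusSite d L → ℂ) :
    ∑ y : FermionTorus d L,
        (if x.toTorusSite = y.toTorusSite + e then c else 0) * Φ y.toTorusSite =
      c * Φ (x.toTorusSite - e) := by
  rw [← Equiv.sum_comp FermionTorus.equivTorusSite.symm]
  have hiff : ∀ z : TorusSite d L, (x.toTorusSite = z + e) ↔ (z = x.toTorusSite - e) := fun z => by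
    rw [eq_sub_iff_add_eq, eq_comm]
  simp only [FermionTorus.equivTorusSite, Equiv.coe_fn_symm_mk,
    FermionTorus.toTorusSite_ofTorusSite, hiff, ite_mul, zero_mul, Finset.sum_ite_eq',
    Finset.mem_univ, if_true]

/-- **Plane-wave inversion of a translation-invariant two-orbital matrix on the fermionic torus.**
If `M` maps every plane wave `y ↦ χ_k(y − w)` in orbital `σ'` to `χ_k(· − w)` times the column
`N̂(k)_{·σ'}` of a `2 × 2` symbol, and `N̂(k) Ŝ(k) = 1` for every momentum `k`, then
`M⁻¹((x,σ),(y,σ')) = L^{-d} Σ_k χ_k(x − y) Ŝ(k)_{σσ'}` (Bloch–Fourier diagonalisation of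
translation-invariant one-body / Nambu matrices; Friedli–Velenik 2017, §10.4 for the characters).
[folklore] -/
theorem inv_apply_eq_sum_torusChar
    (M : Matrix (Orb (FermionTorus d L)) (Orb (FermionTorus d L)) ℂ)
    (Nh Sh : TorusSite d L → Fin 2 → Fin 2 → ℂ)
    (hM : ∀ (k w : TorusSite d L) (x : FermionTorus d L) (σ σ' : Fin 2),
      ∑ y : FermionTorus d L, M (orb x σ) (orb y σ') * torusChar k (y.toTorusSite - w) =
        torusChar k (x.toTorusSite - w) * Nh k σ σ')
    (hNS : ∀ (k : TorusSite d L) (σ σ'' : Fin 2),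
      ∑ σ' : Fin 2, Nh k σ σ' * Sh k σ' σ'' = if σ = σ'' then 1 else 0)
    (a b : Orb (FermionTorus d L)) :
    M⁻¹ a b = ((L : ℂ) ^ d)⁻¹ * ∑ k : TorusSite d L,
      torusChar k ((ofLex a).1.toTorusSite - (ofLex b).1.toTorusSite) *
        Sh k (ofLex a).2 (ofLex b).2 := by
  -- the eigen-equation at the level of orbitals
  have hM' : ∀ (k w : TorusSite d L) (S : Fin 2 → ℂ) (a : Orb (FermionTorus d L)),
      ∑ b : Orb (FermionTorus d L),
          M a b * (torusChar k ((ofLex b).1.toTorusSite - w) * S (ofLex b).2) =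
        torusChar k ((ofLex a).1.toTorusSite - w) * ∑ σ', Nh k (ofLex a).2 σ' * S σ' := by
    intro k w S a
    obtain ⟨⟨x, σ⟩, rfl⟩ : ∃ p : FermionTorus d L × Fin 2, toLex p = a := ⟨ofLex a, rfl⟩
    rw [sum_orb_eq_sum_sum, Finset.sum_comm, Finset.mul_sum]
    refine Finset.sum_congr rfl fun σ' _ => ?_
    have h := hM k w x σ σ'
    simp only [ofLex_toLex]
    calc ∑ y : FermionTorus d L, M (toLex (x, σ)) (orb y σ') *
          (torusChar k (y.toTorusSite - w) * S σ')
        = (∑ y : FermionTorus d L, M (orb x σ) (orb y σ') * torusChar k (y.toTorusSite - w)) *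
            S σ' := by
          rw [Finset.sum_mul]
          exact Finset.sum_congr rfl fun y _ => by ring
      _ = torusChar k (x.toTorusSite - w) * (Nh k σ σ' * S σ') := by rw [h]; ring
  set C : ℂ := ((L : ℂ) ^ d)⁻¹ with hC
  set G : Matrix (Orb (FermionTorus d L)) (Orb (FermionTorus d L)) ℂ := Matrix.of fun a b =>
    C * ∑ k : TorusSite d L, torusChar k ((ofLex a).1.toTorusSite - (ofLex b).1.toTorusSite) *
      Sh k (ofLex a).2 (ofLex b).2 with hG
  suffices h : M * G = 1 by rw [Matrix.inv_eq_right_inv h, hG, Matrix.of_apply]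
  ext a c
  rw [Matrix.mul_apply]
  have step1 : ∑ b, M a b * G b c = C * ∑ k : TorusSite d L,
      torusChar k ((ofLex a).1.toTorusSite - (ofLex c).1.toTorusSite) *
        ∑ σ', Nh k (ofLex a).2 σ' * Sh k σ' (ofLex c).2 := by
    simp only [hG, Matrix.of_apply]
    have hb : ∀ b : Orb (FermionTorus d L), M a b * (C * ∑ k,
        torusChar k ((ofLex b).1.toTorusSite - (ofLex c).1.toTorusSite) *
          Sh k (ofLex b).2 (ofLex c).2) =
        ∑ k, C * (M a b * (torusChar k ((ofLex b).1.toTorusSite - (ofLex c).1.toTorusSite) *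
          Sh k (ofLex b).2 (ofLex c).2)) := fun b => by
      rw [Finset.mul_sum, Finset.mul_sum]
      exact Finset.sum_congr rfl fun k _ => by ring
    calc ∑ b, M a b * (C * ∑ k, torusChar k ((ofLex b).1.toTorusSite - (ofLex c).1.toTorusSite) *
            Sh k (ofLex b).2 (ofLex c).2)
        = ∑ b, ∑ k, C * (M a b * (torusChar k ((ofLex b).1.toTorusSite - (ofLex c).1.toTorusSite) *
            Sh k (ofLex b).2 (ofLex c).2)) := Finset.sum_congr rfl fun b _ => hb b
      _ = ∑ k, ∑ b, C * (M a b * (torusChar k ((ofLex b).1.toTorusSite - (ofLex c).1.toTorusSite) *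
            Sh k (ofLex b).2 (ofLex c).2)) := Finset.sum_comm
      _ = C * ∑ k, ∑ b, M a b * (torusChar k ((ofLex b).1.toTorusSite - (ofLex c).1.toTorusSite) *
            Sh k (ofLex b).2 (ofLex c).2) := by
          rw [Finset.mul_sum]
          exact Finset.sum_congr rfl fun k _ => by rw [Finset.mul_sum]
      _ = _ := by
          congr 1
          exact Finset.sum_congr rfl fun k _ =>
            hM' k (ofLex c).1.toTorusSite (fun τ => Sh k τ (ofLex c).2) a
  rw [step1]
  simp_rw [hNS]
  rw [← Finset.sum_mul, sum_torusChar_left, Matrix.one_apply]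
  obtain ⟨⟨x, σ⟩, rfl⟩ : ∃ p : FermionTorus d L × Fin 2, toLex p = a := ⟨ofLex a, rfl⟩
  obtain ⟨⟨z, σ''⟩, rfl⟩ : ∃ p : FermionTorus d L × Fin 2, toLex p = c := ⟨ofLex c, rfl⟩
  simp only [ofLex_toLex]
  have hsite : (x.toTorusSite - z.toTorusSite = 0) ↔ x = z := by
    rw [sub_eq_zero]
    exact FermionTorus.equivTorusSite.apply_eq_iff_eq
  have hL : (L : ℂ) ^ d ≠ 0 := natCast_pow_ne_zero
  by_cases hxz : x = z
  · subst hxz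
    by_cases hσ : σ = σ''
    · subst hσ
      simp [hC, hL]
    · have : toLex (x, σ) ≠ toLex (x, σ'') := fun h => hσ (by simpa using h)
      simp [hσ, this]
  · have h1 : x.toTorusSite - z.toTorusSite ≠ 0 := fun h => hxz (hsite.mp h)
    have : toLex (x, σ) ≠ toLex (z, σ'') := fun h => hxz (by
      have := congrArg ofLex h; simpa using congrArg Prod.fst this)
    simp [h1, this]

end PlaneWave

/-! ### Momentum sums on the two-dimensional torus as double grid sums -/

section TwoDim

variable {L : ℕ} [NeZero L]

/-- `e^{2πi (j·a)/L} = (e^{2πi a/L})^j` for the standard character of `ℤ/Lℤ`. [folklore] -/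
theorem stdAddChar_natCast_mul (j : ℕ) (a : ZMod L) :
    (ZMod.stdAddChar (((j : ℕ) : ZMod L) * a) : ℂ) =
      Complex.exp (2 * π * Complex.I * (a.val : ℕ) / L) ^ j := by
  obtain ⟨m, hm⟩ : ∃ m : ℕ, ((m : ℕ) : ZMod L) = a := ⟨a.val, ZMod.natCast_zmod_val a⟩
  have hval : a.val = m % L := by rw [← hm, ZMod.val_natCast]
  rw [hval, ← hm, ← Nat.cast_mul, ZMod.stdAddChar_apply, ZMod.toCircle_natCast,
    ← Complex.exp_nat_mul]
  -- reduce `m` modulo `L` in the exponent on the left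
  have hL : (L : ℂ) ≠ 0 := Nat.cast_ne_zero.mpr (NeZero.ne L)
  conv_lhs => rw [← Nat.div_add_mod m L]
  rw [show (2 * π * Complex.I * ((j * (L * (m / L) + m % L) : ℕ) : ℂ) / L) =
      (j * (m / L) : ℕ) * (2 * π * Complex.I) +
        (j : ℂ) * (2 * π * Complex.I * ((m % L : ℕ) : ℂ) / L) by
    push_cast; field_simp]
  rw [Complex.exp_add, Complex.exp_nat_mul_two_pi_mul_I, one_mul]

/-- **Momentum sums on `(ℤ/Lℤ)²` as double grid sums**: reindexing `k = (j₁, j₂)`,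
`Σ_k χ_k(v) Φ(2πk₀/L, 2πk₁/L) = Σ_{j₁ j₂} ω₀^{j₁} ω₁^{j₂} Φ(2πj₁/L, 2πj₂/L)` with
`ωᵢ = e^{2πi vᵢ/L}`. [folklore] -/
theorem sum_torusChar_mul_eq_sum_fin_fin (v : TorusSite 2 L) (Φ : ℝ → ℝ → ℂ) :
    ∑ k : TorusSite 2 L, torusChar k v *
        Φ (2 * π * ((k 0).val : ℕ) / L) (2 * π * ((k 1).val : ℕ) / L) =
      ∑ j₁ : Fin L, ∑ j₂ : Fin L,
        Complex.exp (2 * π * Complex.I * ((v 0).val : ℕ) / L) ^ (j₁ : ℕ) *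
          Complex.exp (2 * π * Complex.I * ((v 1).val : ℕ) / L) ^ (j₂ : ℕ) *
            Φ (2 * π * (j₁ : ℕ) / L) (2 * π * (j₂ : ℕ) / L) := by
  have hv : ∀ j : Fin L, (((j : ℕ) : ZMod L)).val = (j : ℕ) := fun j =>
    ZMod.val_natCast_of_lt j.isLt
  -- the reindexing bijection `(j₁, j₂) ↦ ![j₁, j₂]`
  set e : Fin L × Fin L → TorusSite 2 L := fun p => ![((p.1 : ℕ) : ZMod L), ((p.2 : ℕ) : ZMod L)]
    with he
  have hinj : Function.Injective e := by
    rintro ⟨j₁, j₂⟩ ⟨j₁', j₂'⟩ h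
    have h0 := congrArg ZMod.val (congrFun h 0)
    have h1 := congrArg ZMod.val (congrFun h 1)
    simp only [he, Matrix.cons_val_zero, Matrix.cons_val_one, Matrix.cons_val_fin_one, hv] at h0 h1
    exact Prod.ext (Fin.ext h0) (Fin.ext h1)
  have hbij : Function.Bijective e := by
    refine (Fintype.bijective_iff_injective_and_card e).mpr ⟨hinj, ?_⟩
    simp [Fintype.card_prod, Fintype.card_fin, ZMod.card, sq]
  symm
  calc ∑ j₁ : Fin L, ∑ j₂ : Fin L,
        Complex.exp (2 * π * Complex.I * ((v 0).val : ℕ) / L) ^ (j₁ : ℕ) *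
          Complex.exp (2 * π * Complex.I * ((v 1).val : ℕ) / L) ^ (j₂ : ℕ) *
            Φ (2 * π * (j₁ : ℕ) / L) (2 * π * (j₂ : ℕ) / L)
      = ∑ p : Fin L × Fin L,
        Complex.exp (2 * π * Complex.I * ((v 0).val : ℕ) / L) ^ (p.1 : ℕ) *
          Complex.exp (2 * π * Complex.I * ((v 1).val : ℕ) / L) ^ (p.2 : ℕ) *
            Φ (2 * π * (p.1 : ℕ) / L) (2 * π * (p.2 : ℕ) / L) := (Fintype.sum_prod_type' _).symm
    _ = _ := Fintype.sum_bijective e hbij _ _ fun p => ?_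
  have he0 : e p 0 = ((p.1 : ℕ) : ZMod L) := by simp [he]
  have he1 : e p 1 = ((p.2 : ℕ) : ZMod L) := by simp [he]
  rw [torusChar, Fin.prod_univ_two, he0, he1, hv, hv, stdAddChar_natCast_mul,
    stdAddChar_natCast_mul]

end TwoDim

end Literature.MathematicalPhysics.QuantumLattice

end
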